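import Mathlib
import Summits.MatrixMultiplication.MatrixMultiplication.Theorems.GradedDesignFamily.Negative.CuspFormWallSharp
import Summits.MatrixMultiplication.MatrixMultiplication.Theorems.GradedDesignFamily.Negative.SubfieldCellUniformWall
import Summits.MatrixMultiplication.MatrixMultiplication.Theorems.GradedDesignFamily.Negative.SubfieldCellFixedLines

/-!
# The SHARP counting wall `(|K| + 1)(|k| − 1)` of the quadratic-extension cell for EVERY finite
# field and EVERY injective `φ : SL₂(k) → GL₂(K)`
# (crux `LevelGradedCohnUmans.GradedDesignFamily`, stmt-MatrixMultiplication-7610; negative side,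
# line `quadratic-extension-level-one-cell`, stub S3 `stub_subfieldCell`)

HONEST FRAMING.  This DECIDES nothing about the summit and nothing about the asymptotic stub S3;
it is a THEOREM about its finite cells: for all finite fields `k ⊂ K` with `|K| = |k|²` and EVERY
injective hom `φ` (no embedding classification, no Dickson, no `native_decide`), every S3-separated
pair has `|Y| + |Z| ≤ (|K| + 1)(|k| − 1) = (q² + 1)(q − 1)` — the walls `5, 20, 51, 104, 300, 455, …`
for `q = 2, 3, 4, 5, 7, 8, …`, of which `q ≤ 5` were previously certified case by case.  It
supersedes the `+1` uniform wall (`subfieldCell_wall_uniform`) and the `mapGL`-only sharp wall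
(`subfieldCell_wall_sharp_uniform`).  Consistent with S3 for all `c ≤ 1/2`; NOT summit progress.

THE ARGUMENT (averaged Steinberg kernel vector).  Feed `cuspFormWall_sharp` the elliptic extended
trace cusp form `e` (`SubfieldCellUniformWall`) and the CONSTANT kernel family `κ_ℓ = 1_{Kˣ·w₀}`
for a suitable line representative `w₀`: (hκ0) holds for every `w₀ ≠ 0` (`lineRep_count_smul` +
`Σ e = 0`); (hκ1) asks for a `w₀` whose stabiliser sum `Σ_{t : φ(t) w₀ ∈ Kˣ w₀} e(t)` is non-zero.
AVERAGING over `w₀ ∈ LR ≅ P¹(K)`: `Σ_{w₀} Σ_t e(t)[φ(t) fixes [w₀]] = Σ_t e(t)·fixCount(φ t)`, and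
this is `< 0` for every injective `φ`: `e(1)·fixCount(1) = (1 − q)(|K| + 1)`, the `e(−1)` term is
`≤ 0`, the elliptic terms are `≤ 0`, and the only positive terms are the `≤ 2(|K| − 1)` elements
`t ≠ ±1` of trace `±2`, each with `e(t) = 1` and `fixCount(φ t) ≤ 1` — because `t ^ |k| = 1`
(trace `2`) forces `φ(t) ^ |K| = 1 ≠ φ(t)` and such a matrix fixes at most one line
(`fixCount_le_one`; trace `−2` via `t²`, or via `−1 = 1` in characteristic `2`).  Total
`≤ (1 − q)(|K| + 1) + 2|K| − 2 + (1 − q)·fixCount(φ(−1)) ≤ −4`.  Hence some `w₀` has a non-zero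
stabiliser sum, which is (hκ1).

Contents: `eZ` (integer values of `e`) + `extTraceForm_ellTau_intCast`, `fixCount_phi_trace_two`,
`fixCount_phi_trace_neg_two`, `eZ_fixCount_sum_neg` (the averaged inequality), the wall
`subfieldCell_wall_sharp_all`, the area corollary `subfieldCell_area_le_sharp_all`
(`|Y|·|Z| ≤ ((|K| + 1)(|k| − 1))² / 4`), and `subfieldCell_const_lt_half`: the body of S3 can hold
only with a constant `c < 1/2` (stated on the stub's own quantifier structure; it does NOT refute S3,
which allows any `c > 0`).  Sorry-free; axioms `propext`, `Classical.choice`, `Quot.sound`.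
-/

set_option linter.dupNamespace false

open scoped BigOperators
open Matrix

namespace Summit.MatrixMultiplication.MatrixMultiplication.Theorems.GradedDesignFamily.Negative

variable {k K : Type} [Field k] [Fintype k] [DecidableEq k] [Field K] [Fintype K] [DecidableEq K]

section IntForm

/-- Integer values of the elliptic extended trace form `extTraceForm (ellTau s₀)`. -/
def eZ (s₀ : k) (t : Matrix.SpecialLinearGroup (Fin 2) k) : ℤ :=
  (if Matrix.trace (t : Matrix (Fin 2) (Fin 2) k) = 2 then 1 else 0) +
    (if Matrix.trace (t : Matrix (Fin 2) (Fin 2) k) = -2 then 1 else 0) -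
    (if Matrix.trace (t : Matrix (Fin 2) (Fin 2) k) = s₀ then 1 else 0) -
    (if Matrix.trace (t : Matrix (Fin 2) (Fin 2) k) = -s₀ then 1 else 0) -
    (Fintype.card k : ℤ) * ((if t = 1 then 1 else 0) + (if t = -1 then 1 else 0))

/-- `extTraceForm (ellTau s₀)` is the cast of `eZ s₀`. -/
theorem extTraceForm_ellTau_intCast (s₀ : k) (t : Matrix.SpecialLinearGroup (Fin 2) k) :
    extTraceForm (ellTau s₀) t = ((eZ s₀ t : ℤ) : ℂ) := by
  simp only [extTraceForm_apply, ellTau_apply, eZ, Int.cast_add, Int.cast_sub, Int.cast_mul,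
    Int.cast_ite, Int.cast_one, Int.cast_zero, Int.cast_natCast]

omit [Fintype k] [DecidableEq k] in
/-- In characteristic `2`, `−1 = 1` in `SL₂(k)`. -/
theorem sl_neg_one_eq_one (h2 : (2 : k) = 0) : (-1 : Matrix.SpecialLinearGroup (Fin 2) k) = 1 := by
  have hm : (-1 : k) = 1 := by linear_combination -h2
  apply Subtype.ext
  rw [Matrix.SpecialLinearGroup.coe_neg, Matrix.SpecialLinearGroup.coe_one]
  ext i j
  fin_cases i <;> fin_cases j <;> simp [hm]

end IntForm

section Fix

omit [DecidableEq k] in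
/-- **A trace-`2` element `t ≠ 1` acts (through any injective `φ`) with at most one fixed line.** -/
theorem fixCount_phi_trace_two
    (φ : Matrix.SpecialLinearGroup (Fin 2) k →* Matrix.GeneralLinearGroup (Fin 2) K)
    (hφ : Function.Injective φ) (hK : Fintype.card K = Fintype.card k ^ 2)
    (t : Matrix.SpecialLinearGroup (Fin 2) k) (htr : Matrix.trace (t : Matrix (Fin 2) (Fin 2) k) = 2)
    (ht : t ≠ 1) :
    fixCount ((φ t : Matrix.GeneralLinearGroup (Fin 2) K) : Matrix (Fin 2) (Fin 2) K) ≤ 1 := by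
  refine fixCount_le_one _ ?_ ?_
  · rw [← Units.val_pow_eq_pow_val, ← map_pow, hK, sq, pow_mul, pow_card_eq_one_of_trace_two t htr,
      one_pow, map_one, Units.val_one]
  · intro h
    exact ht (hφ (by rw [map_one]; exact Units.val_eq_one.1 h))

/-- **A trace-`−2` element `t ≠ −1` acts with at most one fixed line** (via `t²`, or via `−1 = 1`
in characteristic `2`). -/
theorem fixCount_phi_trace_neg_two
    (φ : Matrix.SpecialLinearGroup (Fin 2) k →* Matrix.GeneralLinearGroup (Fin 2) K)
    (hφ : Function.Injective φ) (hK : Fintype.card K = Fintype.card k ^ 2)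
    (t : Matrix.SpecialLinearGroup (Fin 2) k)
    (htr : Matrix.trace (t : Matrix (Fin 2) (Fin 2) k) = -2) (ht : t ≠ -1) :
    fixCount ((φ t : Matrix.GeneralLinearGroup (Fin 2) K) : Matrix (Fin 2) (Fin 2) K) ≤ 1 := by
  by_cases h2 : (2 : k) = 0
  · have hSL := sl_neg_one_eq_one h2
    refine fixCount_phi_trace_two φ hφ hK t ?_ (fun h => ht (h.trans hSL.symm))
    rw [htr]
    linear_combination (-2 : k) * h2
  · have htr2 : Matrix.trace ((t * t : Matrix.SpecialLinearGroup (Fin 2) k) :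
        Matrix (Fin 2) (Fin 2) k) = 2 := by
      rw [trace_mul_self, htr]; norm_num
    have hne : t * t ≠ 1 := mul_self_ne_one_of_trace_neg_two t htr h2 ht
    calc fixCount ((φ t : Matrix.GeneralLinearGroup (Fin 2) K) : Matrix (Fin 2) (Fin 2) K)
        ≤ fixCount (((φ t : Matrix.GeneralLinearGroup (Fin 2) K) : Matrix (Fin 2) (Fin 2) K) *
            ((φ t : Matrix.GeneralLinearGroup (Fin 2) K) : Matrix (Fin 2) (Fin 2) K)) :=
          fixCount_le_sq _
      _ = fixCount ((φ (t * t) : Matrix.GeneralLinearGroup (Fin 2) K) :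
            Matrix (Fin 2) (Fin 2) K) := by rw [map_mul, Units.val_mul]
      _ ≤ 1 := fixCount_phi_trace_two φ hφ hK (t * t) htr2 hne

/-- **The averaged stabiliser sum is negative**: `Σ_t eZ(t)·fixCount(φ t) < 0` for every injective
`φ` (the counting argument of the module docstring). -/
theorem eZ_fixCount_sum_neg
    (φ : Matrix.SpecialLinearGroup (Fin 2) k →* Matrix.GeneralLinearGroup (Fin 2) K)
    (hφ : Function.Injective φ) (hK : Fintype.card K = Fintype.card k ^ 2) (s₀ : k) :
    ∑ t : Matrix.SpecialLinearGroup (Fin 2) k, eZ s₀ t *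
      (fixCount ((φ t : Matrix.GeneralLinearGroup (Fin 2) K) : Matrix (Fin 2) (Fin 2) K) : ℤ)
        < 0 := by
  set F : Matrix.SpecialLinearGroup (Fin 2) k → ℤ := fun t =>
    (fixCount ((φ t : Matrix.GeneralLinearGroup (Fin 2) K) : Matrix (Fin 2) (Fin 2) K) : ℤ)
    with hF
  have hq2 : 2 ≤ Fintype.card k := Fintype.one_lt_card
  have F0 : ∀ t, 0 ≤ F t := fun t => by simp only [hF]; positivity
  have F1 : F 1 = (Fintype.card K : ℤ) + 1 := by
    simp only [hF, map_one, Units.val_one, fixCount_one]; push_cast; ring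
  have Fle2 : ∀ t : Matrix.SpecialLinearGroup (Fin 2) k,
      Matrix.trace (t : Matrix (Fin 2) (Fin 2) k) = 2 → t ≠ 1 → F t ≤ 1 := fun t h h' => by
    have := fixCount_phi_trace_two φ hφ hK t h h'
    simp only [hF]
    exact_mod_cast this
  have Flem2 : ∀ t : Matrix.SpecialLinearGroup (Fin 2) k,
      Matrix.trace (t : Matrix (Fin 2) (Fin 2) k) = -2 → t ≠ -1 → F t ≤ 1 := fun t h h' => by
    have := fixCount_phi_trace_neg_two φ hφ hK t h h'
    simp only [hF]
    exact_mod_cast this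
  -- the trace-`±2` sets
  have hT2 : (Finset.univ.filter fun t : Matrix.SpecialLinearGroup (Fin 2) k =>
      Matrix.trace (t : Matrix (Fin 2) (Fin 2) k) = 2).card ≤ Fintype.card K := by
    have h := card_filter_trace_le (k := k) 1 (mul_one 1)
    simp only [one_add_one_eq_two] at h
    rwa [← hK] at h
  have hTm2 : (Finset.univ.filter fun t : Matrix.SpecialLinearGroup (Fin 2) k =>
      Matrix.trace (t : Matrix (Fin 2) (Fin 2) k) = -2).card ≤ Fintype.card K := by
    have h := card_filter_trace_le (k := k) (-1) (by ring)
    have e : ((-1 : k) + -1) = -2 := by ring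
    simp only [e] at h
    rwa [← hK] at h
  have h1T2 : (1 : Matrix.SpecialLinearGroup (Fin 2) k) ∈ Finset.univ.filter
      fun t : Matrix.SpecialLinearGroup (Fin 2) k => Matrix.trace (t : Matrix (Fin 2) (Fin 2) k) = 2 := by
    simp only [Finset.mem_filter, Finset.mem_univ, true_and, Matrix.SpecialLinearGroup.coe_one,
      Matrix.trace_one, Fintype.card_fin]
    norm_num
  have hm1Tm2 : (-1 : Matrix.SpecialLinearGroup (Fin 2) k) ∈ Finset.univ.filter
      fun t : Matrix.SpecialLinearGroup (Fin 2) k =>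
        Matrix.trace (t : Matrix (Fin 2) (Fin 2) k) = -2 := by
    simp only [Finset.mem_filter, Finset.mem_univ, true_and, Matrix.SpecialLinearGroup.coe_neg,
      Matrix.SpecialLinearGroup.coe_one, Matrix.trace_neg, Matrix.trace_one, Fintype.card_fin]
    norm_num
  -- sums over the trace-`±2` sets
  have S2 : ∑ t ∈ Finset.univ.filter (fun t : Matrix.SpecialLinearGroup (Fin 2) k =>
      Matrix.trace (t : Matrix (Fin 2) (Fin 2) k) = 2), F t ≤
        ((Fintype.card K : ℤ) + 1) + ((Fintype.card K : ℤ) - 1) := by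
    rw [← Finset.add_sum_erase _ F h1T2, F1]
    refine add_le_add le_rfl ((Finset.sum_le_card_nsmul _ _ 1 fun t ht => ?_).trans ?_)
    · rw [Finset.mem_erase, Finset.mem_filter] at ht
      exact Fle2 t ht.2.2 ht.1
    · have h1le : 1 ≤ (Finset.univ.filter fun t : Matrix.SpecialLinearGroup (Fin 2) k =>
          Matrix.trace (t : Matrix (Fin 2) (Fin 2) k) = 2).card := Finset.card_pos.2 ⟨1, h1T2⟩
      rw [Finset.card_erase_of_mem h1T2, nsmul_eq_mul, mul_one, Nat.cast_sub h1le, Nat.cast_one]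
      exact sub_le_sub_right (by exact_mod_cast hT2) 1
  have Sm2 : ∑ t ∈ Finset.univ.filter (fun t : Matrix.SpecialLinearGroup (Fin 2) k =>
      Matrix.trace (t : Matrix (Fin 2) (Fin 2) k) = -2), F t ≤
        F (-1) + ((Fintype.card K : ℤ) - 1) := by
    rw [← Finset.add_sum_erase _ F hm1Tm2]
    refine add_le_add le_rfl ((Finset.sum_le_card_nsmul _ _ 1 fun t ht => ?_).trans ?_)
    · rw [Finset.mem_erase, Finset.mem_filter] at ht
      exact Flem2 t ht.2.2 ht.1
    · have h1le : 1 ≤ (Finset.univ.filter fun t : Matrix.SpecialLinearGroup (Fin 2) k =>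
          Matrix.trace (t : Matrix (Fin 2) (Fin 2) k) = -2).card :=
        Finset.card_pos.2 ⟨-1, hm1Tm2⟩
      rw [Finset.card_erase_of_mem hm1Tm2, nsmul_eq_mul, mul_one, Nat.cast_sub h1le, Nat.cast_one]
      exact sub_le_sub_right (by exact_mod_cast hTm2) 1
  -- pointwise bound: drop the (non-positive) elliptic terms
  have hb : ∀ (p : Prop) [Decidable p], (0 : ℤ) ≤ (if p then 1 else 0) := fun p _ => by
    split <;> norm_num
  have hpt : ∀ t : Matrix.SpecialLinearGroup (Fin 2) k, eZ s₀ t * F t ≤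
      ((if Matrix.trace (t : Matrix (Fin 2) (Fin 2) k) = 2 then 1 else 0) +
        (if Matrix.trace (t : Matrix (Fin 2) (Fin 2) k) = -2 then 1 else 0)) * F t -
      (Fintype.card k : ℤ) * (((if t = 1 then 1 else 0) + (if t = -1 then 1 else 0)) * F t) := by
    intro t
    have hs := mul_nonneg (add_nonneg (hb (Matrix.trace (t : Matrix (Fin 2) (Fin 2) k) = s₀))
      (hb (Matrix.trace (t : Matrix (Fin 2) (Fin 2) k) = -s₀))) (F0 t)
    have hid : eZ s₀ t * F t =
        ((if Matrix.trace (t : Matrix (Fin 2) (Fin 2) k) = 2 then 1 else 0) +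
          (if Matrix.trace (t : Matrix (Fin 2) (Fin 2) k) = -2 then 1 else 0)) * F t -
        (Fintype.card k : ℤ) * (((if t = 1 then 1 else 0) + (if t = -1 then 1 else 0)) * F t) -
        ((if Matrix.trace (t : Matrix (Fin 2) (Fin 2) k) = s₀ then 1 else 0) +
          (if Matrix.trace (t : Matrix (Fin 2) (Fin 2) k) = -s₀ then 1 else 0)) * F t := by
      rw [eZ]; ring
    rw [hid]
    linarith
  have hsum : ∑ t : Matrix.SpecialLinearGroup (Fin 2) k,
      (((if Matrix.trace (t : Matrix (Fin 2) (Fin 2) k) = 2 then 1 else 0) +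
        (if Matrix.trace (t : Matrix (Fin 2) (Fin 2) k) = -2 then 1 else 0)) * F t -
      (Fintype.card k : ℤ) * (((if t = 1 then 1 else 0) + (if t = -1 then 1 else 0)) * F t)) =
      (∑ t ∈ Finset.univ.filter (fun t : Matrix.SpecialLinearGroup (Fin 2) k =>
          Matrix.trace (t : Matrix (Fin 2) (Fin 2) k) = 2), F t) +
      (∑ t ∈ Finset.univ.filter (fun t : Matrix.SpecialLinearGroup (Fin 2) k =>
          Matrix.trace (t : Matrix (Fin 2) (Fin 2) k) = -2), F t) -
      (Fintype.card k : ℤ) * (F 1 + F (-1)) := by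
    simp only [add_mul, boole_mul, Finset.sum_sub_distrib, Finset.sum_add_distrib, ← Finset.mul_sum,
      Finset.sum_ite_eq', Finset.mem_univ, if_true, Finset.sum_filter]
  have total : ∑ t : Matrix.SpecialLinearGroup (Fin 2) k, eZ s₀ t * F t ≤
      ((Fintype.card K : ℤ) + 1) + ((Fintype.card K : ℤ) - 1) +
        (F (-1) + ((Fintype.card K : ℤ) - 1)) -
        (Fintype.card k : ℤ) * (((Fintype.card K : ℤ) + 1) + F (-1)) := by
    calc ∑ t : Matrix.SpecialLinearGroup (Fin 2) k, eZ s₀ t * F t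
        ≤ ∑ t : Matrix.SpecialLinearGroup (Fin 2) k,
            (((if Matrix.trace (t : Matrix (Fin 2) (Fin 2) k) = 2 then 1 else 0) +
              (if Matrix.trace (t : Matrix (Fin 2) (Fin 2) k) = -2 then 1 else 0)) * F t -
            (Fintype.card k : ℤ) * (((if t = 1 then 1 else 0) + (if t = -1 then 1 else 0)) * F t)) :=
          Finset.sum_le_sum fun t _ => hpt t
      _ = _ := hsum
      _ ≤ _ := by
          rw [F1]
          have hq0 : (0 : ℤ) ≤ (Fintype.card k : ℤ) := by positivity
          nlinarith [S2, Sm2, F0 (-1)]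
  have hq2' : (2 : ℤ) ≤ (Fintype.card k : ℤ) := by exact_mod_cast hq2
  have hQ0 : (0 : ℤ) ≤ (Fintype.card K : ℤ) := by positivity
  rcases eq_or_lt_of_le hq2 with h2 | h3
  · -- `q = 2`: `−1 = 1`, so `F (−1) = |K| + 1`
    have hc2 : (2 : k) = 0 := by
      have h := FiniteField.cast_card_eq_zero k
      rw [← h2] at h
      exact_mod_cast h
    have hm1 : F (-1) = (Fintype.card K : ℤ) + 1 := by rw [sl_neg_one_eq_one hc2, F1]
    rw [hm1] at total
    have hq : (Fintype.card k : ℤ) = 2 := by exact_mod_cast h2.symm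
    rw [hq] at total
    linarith
  · have h3' : (3 : ℤ) ≤ (Fintype.card k : ℤ) := by exact_mod_cast h3
    nlinarith [total, F0 (-1), mul_nonneg (sub_nonneg.2 h3') (F0 (-1)),
      mul_nonneg (sub_nonneg.2 h3') hQ0]

end Fix

section Wall

/-- **The SHARP counting wall for EVERY finite field and EVERY injective `φ`.**  For all finite
fields `k`, `K` with `|K| = |k|²` and every injective hom `φ : SL₂(k) → GL₂(K)`, every pair
`(Y, Z)` separated in the sense of S3 satisfies `|Y| + |Z| ≤ (|K| + 1)(|k| − 1)` — the walls
`5, 20, 51, 104, 300, …` for `q = 2, 3, 4, 5, 7, …`.  Proof: `cuspFormWall_sharp` with the elliptic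
extended trace cusp form and the constant punctured-line kernel family at a line representative
`w₀` with non-zero stabiliser sum, which exists by the averaged inequality `eZ_fixCount_sum_neg`.
A finite-cell theorem consistent with S3 (for `c ≤ 1/2`); not summit progress. -/
theorem subfieldCell_wall_sharp_all
    (φ : Matrix.SpecialLinearGroup (Fin 2) k →* Matrix.GeneralLinearGroup (Fin 2) K)
    (hφ : Function.Injective φ) (hK : Fintype.card K = Fintype.card k ^ 2)
    (Y Z : Finset (Matrix.GeneralLinearGroup (Fin 2) K)) (hY : Y.Nonempty) (hZ : Z.Nonempty)
    (hsep : ∀ z₀ ∈ Z, ∃ cf : (Fin 2 → K) → (Fin 2 → K) → ℂ,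
      ∀ a : Matrix.SpecialLinearGroup (Fin 2) k, ∀ y ∈ Y, ∀ y' ∈ Y, ∀ z ∈ Z,
        (∑ u : Fin 2 → K, cf u (((φ a * y * y'⁻¹ * z : Matrix.GeneralLinearGroup (Fin 2) K) :
            Matrix (Fin 2) (Fin 2) K).mulVec u)) =
          if a = 1 ∧ y = y' ∧ z = z₀ then 1 else 0) :
    Y.card + Z.card ≤ (Fintype.card K + 1) * (Fintype.card k - 1) := by
  classical
  obtain ⟨s₀, hs₀⟩ := exists_elliptic_trace k
  have hcusp := extTraceForm_cusp (ellTau s₀) (ellTau_sum s₀) (ellTau_split s₀ hs₀)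
  -- the averaged stabiliser sum is negative, so some line representative has a non-zero one
  have hneg := eZ_fixCount_sum_neg φ hφ hK s₀
  have hF : ∀ t : Matrix.SpecialLinearGroup (Fin 2) k,
      (fixCount ((φ t : Matrix.GeneralLinearGroup (Fin 2) K) : Matrix (Fin 2) (Fin 2) K) : ℤ) =
      ∑ w₀ ∈ insert ![0, 1] (Finset.univ.image fun x : K => ![1, x]),
        (if ∃ c : K, c ≠ 0 ∧ ((φ t : Matrix.GeneralLinearGroup (Fin 2) K) :
            Matrix (Fin 2) (Fin 2) K) *ᵥ w₀ = c • w₀ then (1 : ℤ) else 0) := by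
    intro t
    rw [Finset.sum_boole, fixCount_def]
  simp_rw [hF, Finset.mul_sum] at hneg
  rw [Finset.sum_comm] at hneg
  obtain ⟨w₀, hw₀, hne⟩ : ∃ w₀ ∈ insert ![0, 1] (Finset.univ.image fun x : K => ![1, x]),
      ∑ t : Matrix.SpecialLinearGroup (Fin 2) k, eZ s₀ t *
        (if ∃ c : K, c ≠ 0 ∧ ((φ t : Matrix.GeneralLinearGroup (Fin 2) K) :
            Matrix (Fin 2) (Fin 2) K) *ᵥ w₀ = c • w₀ then (1 : ℤ) else 0) ≠ 0 := by
    by_contra! h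
    exact hneg.ne (Finset.sum_eq_zero h)
  have hw₀0 : w₀ ≠ 0 := lineRep_ne_zero hw₀
  refine cuspFormWall_sharp φ hφ hK Y Z hY hZ hsep (extTraceForm (ellTau s₀))
    ⟨_, extTraceForm_ellTau_ne_zero s₀ hs₀⟩ hcusp
    (fun _ w => if ∃ c : K, c ≠ 0 ∧ w = c • w₀ then 1 else 0) ?_ ?_
  · -- (hκ0): exactly one representative lands in the punctured line, and `Σ e = 0`
    intro g
    rw [Finset.sum_comm]
    simp_rw [← Finset.mul_sum, Matrix.mulVec_mulVec, ← Units.val_mul, lineRep_count_smul _ hw₀0,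
      mul_one]
    exact cuspForm_sum_eq_zero _ hcusp
  · -- (hκ1): the stabiliser sum at `w₀`
    refine ⟨![0, 1], Finset.mem_insert_self _ _, w₀, fun h => hne ?_⟩
    have hcast : (((∑ t : Matrix.SpecialLinearGroup (Fin 2) k, eZ s₀ t *
        (if ∃ c : K, c ≠ 0 ∧ ((φ t : Matrix.GeneralLinearGroup (Fin 2) K) :
            Matrix (Fin 2) (Fin 2) K) *ᵥ w₀ = c • w₀ then (1 : ℤ) else 0) : ℤ)) : ℂ) =
        ∑ t : Matrix.SpecialLinearGroup (Fin 2) k, extTraceForm (ellTau s₀) t *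
          (if ∃ c : K, c ≠ 0 ∧ ((φ t : Matrix.GeneralLinearGroup (Fin 2) K) :
            Matrix (Fin 2) (Fin 2) K) *ᵥ w₀ = c • w₀ then (1 : ℂ) else 0) := by
      push_cast
      simp_rw [extTraceForm_ellTau_intCast]
    exact_mod_cast hcast.trans h

/-- Corollary (AM–GM): for every finite field and every injective `φ`, `4·|Y|·|Z| ≤ ((|K|+1)(|k|−1))²`. -/
theorem subfieldCell_area_le_sharp_all
    (φ : Matrix.SpecialLinearGroup (Fin 2) k →* Matrix.GeneralLinearGroup (Fin 2) K)
    (hφ : Function.Injective φ) (hK : Fintype.card K = Fintype.card k ^ 2)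
    (Y Z : Finset (Matrix.GeneralLinearGroup (Fin 2) K)) (hY : Y.Nonempty) (hZ : Z.Nonempty)
    (hsep : ∀ z₀ ∈ Z, ∃ cf : (Fin 2 → K) → (Fin 2 → K) → ℂ,
      ∀ a : Matrix.SpecialLinearGroup (Fin 2) k, ∀ y ∈ Y, ∀ y' ∈ Y, ∀ z ∈ Z,
        (∑ u : Fin 2 → K, cf u (((φ a * y * y'⁻¹ * z : Matrix.GeneralLinearGroup (Fin 2) K) :
            Matrix (Fin 2) (Fin 2) K).mulVec u)) =
          if a = 1 ∧ y = y' ∧ z = z₀ then 1 else 0) :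
    4 * (Y.card * Z.card) ≤ ((Fintype.card K + 1) * (Fintype.card k - 1)) ^ 2 := by
  have h := subfieldCell_wall_sharp_all φ hφ hK Y Z hY hZ hsep
  calc 4 * (Y.card * Z.card) ≤ (Y.card + Z.card) ^ 2 := by
        nlinarith [sq_nonneg ((Y.card : ℤ) - Z.card)]
    _ ≤ ((Fintype.card K + 1) * (Fintype.card k - 1)) ^ 2 := Nat.pow_le_pow_left h 2

/-- **The constant of S3 is less than `1/2`.**  If the body of `stub_subfieldCell` holds with a
constant `c` (even for the single value `N = 0`), then `c < 1/2`: the cell it provides has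
`2c·|K|^{3/2} ≤ |Y| + |Z| ≤ (|K| + 1)(|k| − 1) = q³ − q² + q − 1 < q³ = |K|^{3/2}`.  This does NOT
refute S3 (which allows any `c > 0`); it is the exact finite-cell content of the counting wall,
stated on the stub's own quantifier structure.  Not summit progress. -/
theorem subfieldCell_const_lt_half (c : ℝ)
    (h : ∀ N : ℕ, ∃ (k K : Type) (_ : Field k) (_ : Fintype k) (_ : DecidableEq k)
      (_ : Field K) (_ : Fintype K) (_ : DecidableEq K)
      (φ : Matrix.SpecialLinearGroup (Fin 2) k →* Matrix.GeneralLinearGroup (Fin 2) K),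
      Function.Injective φ ∧ Fintype.card K = Fintype.card k ^ 2 ∧ N ≤ Fintype.card K ∧
      ∃ Y Z : Finset (Matrix.GeneralLinearGroup (Fin 2) K),
        c * (Fintype.card K : ℝ) ^ (3 / 2 : ℝ) ≤ (Finset.univ.image φ).card ∧
        c * (Fintype.card K : ℝ) ^ (3 / 2 : ℝ) ≤ Y.card ∧
        c * (Fintype.card K : ℝ) ^ (3 / 2 : ℝ) ≤ Z.card ∧
        ∀ z₀ ∈ Z, ∃ cf : (Fin 2 → K) → (Fin 2 → K) → ℂ,
          ∀ a : Matrix.SpecialLinearGroup (Fin 2) k, ∀ y ∈ Y, ∀ y' ∈ Y, ∀ z ∈ Z,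
            (∑ u : Fin 2 → K, cf u (((φ a * y * y'⁻¹ * z : Matrix.GeneralLinearGroup (Fin 2) K) :
                Matrix (Fin 2) (Fin 2) K).mulVec u)) =
              if a = 1 ∧ y = y' ∧ z = z₀ then 1 else 0) :
    c < 1 / 2 := by
  classical
  obtain ⟨k, K, _, _, _, _, _, _, φ, hφ, hK, -, Y, Z, -, hY, hZ, hsep⟩ := h 0
  by_cases hc : c ≤ 0
  · linarith
  push Not at hc
  have hq2 : 2 ≤ Fintype.card k := Fintype.one_lt_card
  have hQpos : (0 : ℝ) < (Fintype.card K : ℝ) ^ (3 / 2 : ℝ) :=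
    Real.rpow_pos_of_pos (by exact_mod_cast Fintype.card_pos) _
  have hYne : Y.Nonempty := by
    rw [← Finset.card_pos]
    have h0 : (0 : ℝ) < Y.card := lt_of_lt_of_le (mul_pos hc hQpos) hY
    exact_mod_cast h0
  have hZne : Z.Nonempty := by
    rw [← Finset.card_pos]
    have h0 : (0 : ℝ) < Z.card := lt_of_lt_of_le (mul_pos hc hQpos) hZ
    exact_mod_cast h0
  have wall := subfieldCell_wall_sharp_all φ hφ hK Y Z hYne hZne hsep
  have h1 : 1 ≤ Fintype.card k := by omega
  have hwallR : ((Y.card : ℝ) + Z.card) ≤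
      ((Fintype.card K : ℝ) + 1) * ((Fintype.card k : ℝ) - 1) := by
    have h' : ((Y.card + Z.card : ℕ) : ℝ) ≤
        (((Fintype.card K + 1) * (Fintype.card k - 1) : ℕ) : ℝ) := by exact_mod_cast wall
    push_cast [Nat.cast_sub h1] at h'
    exact h'
  have hKR : (Fintype.card K : ℝ) = (Fintype.card k : ℝ) ^ 2 := by exact_mod_cast hK
  have hpow : (Fintype.card K : ℝ) ^ (3 / 2 : ℝ) = (Fintype.card k : ℝ) ^ 3 := by
    rw [hKR, ← Real.rpow_natCast (Fintype.card k : ℝ) 2, ← Real.rpow_mul (by positivity),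
      show ((2 : ℕ) : ℝ) * (3 / 2 : ℝ) = ((3 : ℕ) : ℝ) by norm_num, Real.rpow_natCast]
  rw [hpow] at hY hZ
  rw [hKR] at hwallR
  have hq : (2 : ℝ) ≤ (Fintype.card k : ℝ) := by exact_mod_cast hq2
  by_contra hcc
  push Not at hcc
  have hq3 : (0 : ℝ) < (Fintype.card k : ℝ) ^ 3 := by positivity
  have h2 : (Fintype.card k : ℝ) ^ 3 ≤ 2 * c * (Fintype.card k : ℝ) ^ 3 := by nlinarith
  nlinarith [hY, hZ, hwallR]

end Wall

end Summit.MatrixMultiplication.MatrixMultiplication.Theorems.GradedDesignFamily.Negative
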